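import Literature.AlgebraicGeometry.HodgeTheory.QuaternionicQuarticFamilyDeck
import Literature.AlgebraicGeometry.HodgeTheory.QuaternionicQuarticGenericModel
import Literature.AlgebraicGeometry.HodgeTheory.QuaternionicQuarticFamilyOfCover
import Literature.AlgebraicGeometry.Limits.SmoothProjectiveSpreadEquivariant
import HarnessLib

/-!
# «M1» assembly: `Q8FamilyDeck e` holds for every `e ≥ 2`, modulo Kollár's functorial resolution
# (programme M1, brick M1-5; route `HodgeConjecture/Q8SymplecticPowers`, crux K1Q)

Layer `Literature/AlgebraicGeometry/HodgeTheory`. One theorem, no definition, no new named fact. Written by the prover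
seat `hodge-nonav-prover-Bx` (g19, cell `hodge-nonav`), programme M1 (memo `PROGRAMME-M1-Bx-g19.md`, p3 g36 08:41:37Z) for
crux K1Q (stmt-HodgeConjecture-24190): it discharges the statement `Q8Family.Q8FamilyDeck e` (= stub S6 `stub_familyDeckExistsQ`
of the K1Q skeleton `mechanism-v2`) for every `e ≥ 2`, CONDITIONALLY on the one named fact of the programme,
`Resolution.Kollar2007_resolutionLiftsAutomorphisms` (Kollár 2007, Thm. 3.36 + §3.4.1: the functorial resolution commutes with
automorphisms).

`q8FamilyDeck_holds` — proof: (1) the generic chart `𝒰_K` of the normalised quartic cover with its `Q₈`-action and the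
`Q₈`-equivariant smooth projective model `θ : 𝒰_K ↪ E` (M1-4a `exists_genericModel`, conditional on Kollár); (2) the
equivariant spreading out (M1-4b `Limits.exists_projectiveModel_equivariant`): a projective `A`-model `Pm`, `t ≠ 0`, and over
`T = A[1/t]` a `Q₈`-action `σ` on `Pm_T` over `Spec T` with a `Q₈`-equivariant open immersion `Θ : 𝒰_T ↪ Pm_T` over `Spec T`
meeting every fibre; (3) the family `𝒳 = Pm ×_A W → W = D(t)` packaged exactly as in QF-5b `qFamily_of_cover` (complex points of
`W`, smoothness ∕ properness ∕ geometric irreducibility of `Pm_T → Spec T` transported along `W ≅ Spec T`, quasi-projectivity,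
smooth base), with `τ = σ(a 1)`, `j = σ(xa 0)` and `ι = Θ` transported along the isomorphism `W ≅ Spec T` by whiskering in
`Over (Spec A)`; the quaternion relations follow from those in `Q₈` (`a 1 ^ 4 = 1`, `xa 0 ^ 2 = a 1 ^ 2`,
`a 1 * xa 0 * a 1 = xa 0`). Honest scope: `Q8FamilyDeck e` modulo Kollár's theorem; nothing here bears on HC, and K1Q is NOT
proved here.

## References

* [Kollar2007] J. Kollár, Lectures on Resolution of Singularities (2007), Thm. 3.36, §3.4.1.
* [EGAIV3] A. Grothendieck, J. Dieudonné, EGA IV₃ (1966), Thm. 8.10.5.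
* [Hartshorne1977] R. Hartshorne, Algebraic Geometry (1977), III §10.
-/

noncomputable section

open CategoryTheory CategoryTheory.Limits AlgebraicGeometry TopologicalSpace MvPolynomial
  MonoidalCategory CartesianMonoidalCategory
open Literature.AlgebraicGeometry.Morphisms Literature.AlgebraicGeometry.Motives
open Literature.AlgebraicGeometry.HodgeTheory.SpreadingOutQbar
open Literature.AlgebraicGeometry.Resolution Literature.AlgebraicGeometry.Limits
open Literature.AlgebraicGeometry.RelativeSpec

namespace Literature.AlgebraicGeometry.HodgeTheory.Q8Family

/-- The parameter ring `ℂ[a]` is integrally closed (a UFD); recorded BEFORE the transparency option of the main proof is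
switched on (under `backward.isDefEq.respectTransparency false` this instance search times out). [folklore] -/
private theorem isIntegrallyClosed_paramRing (e : ℕ) : IsIntegrallyClosed (ParamRing e) := inferInstance

set_option backward.isDefEq.respectTransparency false

/-- **The family with deck pair over a base inside any prescribed `D(G)`, `G ≠ 0`, modulo Kollár's functorial resolution**
(programme M1, brick M1-5; the clauses are those of `Q8FamilyDeck e`, plus `W ⊆ D(G)` — room for the later fibrewise
birationality clause (iii), which needs the base shrunk to the locus of irreducible quartics; see the module docstring for the
proof). [cite: Kollar2007, Thm. 3.36 and §3.4.1] [cite: EGAIV3, Thm. 8.10.5] [cite: Hartshorne1977, III §10] -/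
theorem q8FamilyDeck_holds_away (h : Kollar2007_resolutionLiftsAutomorphisms.{0}) (e : ℕ) (he : 2 ≤ e)
    (G : ParamRing e) (hG : G ≠ 0) :
    ∃ (W : (Spec (.of (ParamRing e))).Opens) (𝒳 : SchemeOver ℂ) (π : 𝒳 ⟶ base W) (τ j : 𝒳 ⟶ 𝒳)
      (ι : (deckChart (fun i => (MvPolynomial.X i : ParamRing e)) ⊗ Over.mk W.ι).left ⟶ 𝒳.left),
      W ≤ PrimeSpectrum.basicOpen G ∧
      Nonempty (ComplexPoints (base W)) ∧ IsSmoothProjectiveFamily π 2 ∧ IsQuasiProjectiveOver 𝒳 ∧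
      IsQuasiProjectiveOver (base W) ∧ AlgebraicGeometry.SmoothOfRelativeDimension (Fintype.card (CIdx e)) (base W).hom ∧
      (τ ≫ π = π ∧ j ≫ π = π ∧ τ ≫ τ ≫ τ ≫ τ = 𝟙 𝒳 ∧ j ≫ j = τ ≫ τ ∧ τ ≫ j ≫ τ = j) ∧
      IsOpenImmersion ι ∧ ι ≫ π.left = (snd (deckChart (fun i => (MvPolynomial.X i : ParamRing e))) (Over.mk W.ι)).left ∧
      ((Over.isoMk ((deckAction (fun i => (MvPolynomial.X i : ParamRing e))).aut (QuaternionGroup.a 1))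
          ((deckAction (fun i => (MvPolynomial.X i : ParamRing e))).aut_comp (QuaternionGroup.a 1))).hom ▷
            Over.mk W.ι).left ≫ ι = ι ≫ τ.left ∧
      ((Over.isoMk ((deckAction (fun i => (MvPolynomial.X i : ParamRing e))).aut (QuaternionGroup.xa 0))
          ((deckAction (fun i => (MvPolynomial.X i : ParamRing e))).aut_comp (QuaternionGroup.xa 0))).hom ▷
            Over.mk W.ι).left ≫ ι = ι ≫ j.left ∧
      Function.Surjective (snd (deckChart (fun i => (MvPolynomial.X i : ParamRing e))) (Over.mk W.ι)).left := by
  classical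
  have _iGA : ∀ {σ R : Type} [CommSemiring R], GradedAlgebra (MvPolynomial.homogeneousSubmodule σ R) :=
    @MvPolynomial.gradedAlgebra
  -- ### (1) the generic chart, its action and its equivariant smooth projective model (M1-4a)
  let K : Type := FractionRing (ParamRing e)
  let U : SchemeOver (ParamRing e) := univChart e
  let ρU : ActionOver U.hom (QuaternionGroup 2) := deckAction (univVec e)
  obtain ⟨E, ρE, θ, hE, hθopen, hθeq⟩ := exists_genericModel e h he
  haveI := hθopen
  haveI : QuasiCompact U.hom := by
    change QuasiCompact (Spec.map _)
    infer_instance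
  haveI : QuasiSeparated U.hom := by
    change QuasiSeparated (Spec.map _)
    infer_instance
  haveI : SmoothOfRelativeDimension 2 U.hom := smoothOfRelativeDimension_deckChart (univVec e)
  haveI : Smooth U.hom := SmoothOfRelativeDimension.smooth 2 _
  haveI : LocallyOfFinitePresentation U.hom := inferInstance
  haveI : Flat U.hom := inferInstance
  haveI : IsIntegral (genericChart e K).left := isIntegral_genericChart e K he
  haveI : Nonempty ↥(U ⊗ specOver (ParamRing e) K).left :=
    inferInstanceAs (Nonempty ↥(genericChart e K).left)
  have hθ : θ.left ≫ E.hom = (snd U (specOver (ParamRing e) K)).left := Over.w θ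
  have hθeq' : ∀ g : QuaternionGroup 2,
      ((ρU.tensorRight (specOver (ParamRing e) K)).aut g).hom ≫ θ.left = θ.left ≫ (ρE.aut g).hom := hθeq
  -- ### (2) the equivariant spreading out (M1-4b)
  haveI : IsIntegrallyClosed (ParamRing e) := isIntegrallyClosed_paramRing e
  obtain ⟨N, Pm, emb, hemb, gen, t, ht, -, Hloc, Hdeck⟩ :=
    exists_projectiveModel_equivariant (A := ParamRing e) (K := K) U ρU hE ρE θ.left hθ hθeq'
  have htG : t * G ≠ 0 := mul_ne_zero ht hG
  obtain ⟨σ, Θ, -, hΘopen, hΘsnd, hΘeq, hsurj, -, -, -, -⟩ := Hdeck (t * G) (dvd_mul_right t G) htG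
  clear Hdeck gen
  haveI := hemb
  haveI : IsProper (ProjBaseChangeRing.projToSpec (Fin (N + 1)) (ParamRing e)) :=
    ProjBaseChangeRing.isProper_projToSpec _ _
  -- fold `f = emb ≫ (ℙᴺ_A → Spec A)` everywhere (including the types of `σ`, `Θ`)
  generalize hf : emb ≫ ProjBaseChangeRing.projToSpec (Fin (N + 1)) (ParamRing e) = f at σ Θ hΘopen hΘsnd hΘeq Hloc
  haveI : IsProper f := by rw [← hf]; infer_instance
  haveI := hΘopen
  let T : Type := Localization.Away (t * G)
  let jT : Spec (.of T) ⟶ Spec (.of (ParamRing e)) := Spec.map (CommRingCat.ofHom (algebraMap (ParamRing e) T))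
  let Pf : SchemeOver (ParamRing e) := Over.mk f
  -- the M1-4b data, retyped on `Pf ⊗ Spec T` (same objects)
  let σ₁ : ActionOver (snd Pf (specOver (ParamRing e) T)).left (QuaternionGroup 2) := σ
  let Θ₁ : (U ⊗ specOver (ParamRing e) T).left ⟶ (Pf ⊗ specOver (ParamRing e) T).left := Θ
  have hσc : ∀ g, (σ₁.aut g).hom ≫ (snd Pf (specOver (ParamRing e) T)).left = (snd Pf (specOver (ParamRing e) T)).left :=
    fun g => σ.aut_comp g
  have hΘ₁snd : Θ₁ ≫ (snd Pf (specOver (ParamRing e) T)).left = (snd U (specOver (ParamRing e) T)).left := hΘsnd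
  have hΘ₁eq : ∀ g, ((ρU.tensorRight (specOver (ParamRing e) T)).aut g).hom ≫ Θ₁ = Θ₁ ≫ (σ₁.aut g).hom := hΘeq
  haveI : IsOpenImmersion Θ₁ := hΘopen
  -- ### (3) the base `W = D(tG) ≅ Spec T`
  let W : (Spec (.of (ParamRing e))).Opens := PrimeSpectrum.basicOpen (t * G)
  have hmemW : ∀ {L : Type} [Field L] (φ : ParamRing e →+* L) (x : Spec (.of L)),
      Spec.map (CommRingCat.ofHom φ) x ∈ W ↔ φ (t * G) ≠ 0 := by
    intro L _ φ x
    have h1 : Spec.map (CommRingCat.ofHom φ) x ∈ W ↔ φ (t * G) ∉ x.asIdeal := Iff.rfl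
    rw [h1, Ideal.eq_bot_of_prime x.asIdeal, Ideal.mem_bot]
  have hWT : Set.range W.ι = Set.range jT := by
    rw [Scheme.Opens.range_ι]
    change ((PrimeSpectrum.basicOpen (t * G) : Opens _) : Set _) =
      Set.range (PrimeSpectrum.comap (algebraMap (ParamRing e) T))
    rw [PrimeSpectrum.localization_away_comap_range T (t * G)]
  let ℓi : (W : Scheme) ≅ Spec (.of T) := IsOpenImmersion.isoOfRangeEq W.ι jT hWT
  have hℓ : ℓi.hom ≫ jT = W.ι := IsOpenImmersion.isoOfRangeEq_hom_fac _ _ _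
  let Wo : SchemeOver (ParamRing e) := Over.mk W.ι
  let ℓo : Wo ≅ specOver (ParamRing e) T := Over.isoMk ℓi hℓ
  -- the family `𝒳 = Pm ×_A W → W`
  let 𝒳 : SchemeOver ℂ := Over.mk (pullback.snd f W.ι ≫ (base W).hom)
  let π : 𝒳 ⟶ base W := Over.homMk (pullback.snd f W.ι) rfl
  have h𝒳 : 𝒳.left = (Pf ⊗ Wo).left := rfl
  have hπ : π.left = (snd Pf Wo).left := rfl
  -- the transport isomorphisms `Pf ⊗ Wo ≅ Pf ⊗ Spec T`, `U ⊗ Wo ≅ U ⊗ Spec T`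
  let mI : Pf ⊗ Wo ≅ Pf ⊗ specOver (ParamRing e) T := whiskerLeftIso Pf ℓo
  let nI : U ⊗ Wo ≅ U ⊗ specOver (ParamRing e) T := whiskerLeftIso U ℓo
  have hmI_snd : mI.hom ≫ snd Pf (specOver (ParamRing e) T) = snd Pf Wo ≫ ℓo.hom := whiskerLeft_snd _ _
  have hmIinv_snd : mI.inv ≫ snd Pf Wo = snd Pf (specOver (ParamRing e) T) ≫ ℓo.inv := by
    change (Pf ◁ ℓo.inv) ≫ _ = _
    exact whiskerLeft_snd _ _
  have hnI_snd : nI.hom ≫ snd U (specOver (ParamRing e) T) = snd U Wo ≫ ℓo.hom := whiskerLeft_snd _ _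
  have sqT : IsPullback mI.hom.left (pullback.snd Pf.hom Wo.hom) (pullback.snd Pf.hom (specOver (ParamRing e) T).hom)
      ℓo.hom.left :=
    SubalgApprox.isPullback_whiskerLeft_left Pf ℓo.hom
  -- the automorphisms `σ(g)` as isomorphisms over `Spec A`, and their conjugates on `Pf ⊗ Wo`
  let σo : QuaternionGroup 2 → (Pf ⊗ specOver (ParamRing e) T ≅ Pf ⊗ specOver (ParamRing e) T) := fun g =>
    Over.isoMk (σ₁.aut g) (by
      rw [← Over.w (snd Pf (specOver (ParamRing e) T)), reassoc_of% (hσc g)])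
  have hσo_left : ∀ g, (σo g).hom.left = (σ₁.aut g).hom := fun g => rfl
  have hσo_snd : ∀ g, (σo g).hom ≫ snd Pf (specOver (ParamRing e) T) = snd Pf (specOver (ParamRing e) T) := fun g =>
    Over.OverMorphism.ext (hσc g)
  have hσo_mul : ∀ g g' : QuaternionGroup 2, (σo (g * g')).hom = (σo g').hom ≫ (σo g).hom := fun g g' =>
    Over.OverMorphism.ext (by rw [Over.comp_left, hσo_left, hσo_left, hσo_left, map_mul, Aut.Aut_mul_def, Iso.trans_hom])
  have hσo_one : (σo 1).hom = 𝟙 _ := Over.OverMorphism.ext (by rw [hσo_left, map_one, Over.id_left]; rfl)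
  let conj : QuaternionGroup 2 → (Pf ⊗ Wo ⟶ Pf ⊗ Wo) := fun g => mI.hom ≫ (σo g).hom ≫ mI.inv
  have hconj_snd : ∀ g, conj g ≫ snd Pf Wo = snd Pf Wo := by
    intro g
    change (mI.hom ≫ (σo g).hom ≫ mI.inv) ≫ snd Pf Wo = snd Pf Wo
    rw [Category.assoc, Category.assoc, hmIinv_snd, reassoc_of% (hσo_snd g), reassoc_of% hmI_snd, Iso.hom_inv_id,
      Category.comp_id]
  have hconj_mul : ∀ g g', conj g ≫ conj g' = conj (g' * g) := by
    intro g g'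
    change (mI.hom ≫ (σo g).hom ≫ mI.inv) ≫ (mI.hom ≫ (σo g').hom ≫ mI.inv) = mI.hom ≫ (σo (g' * g)).hom ≫ mI.inv
    rw [hσo_mul]
    simp only [Category.assoc, Iso.inv_hom_id_assoc]
  have hconj_one : conj 1 = 𝟙 _ := by
    change mI.hom ≫ (σo 1).hom ≫ mI.inv = 𝟙 _
    rw [hσo_one, Category.id_comp, Iso.hom_inv_id]
  -- endomorphisms of `𝒳` over `W` (hence over `ℂ`) from morphisms of `Pf ⊗ Wo` over `Wo`
  have hbase : 𝒳.hom = (snd Pf Wo).left ≫ (base W).hom := rfl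
  let endo : ∀ φ : Pf ⊗ Wo ⟶ Pf ⊗ Wo, φ ≫ snd Pf Wo = snd Pf Wo → (𝒳 ⟶ 𝒳) := fun φ hφ =>
    Over.homMk φ.left (by rw [hbase, ← Category.assoc, ← Over.comp_left, hφ])
  have hendo_left : ∀ φ hφ, (endo φ hφ).left = φ.left := fun _ _ => rfl
  have hendo_π : ∀ φ hφ, endo φ hφ ≫ π = π := fun φ hφ =>
    Over.OverMorphism.ext (by rw [Over.comp_left, hendo_left φ hφ, hπ, ← Over.comp_left, hφ])
  have key₁ : ∀ q : QuaternionGroup 2, q = 1 → (conj q).left = 𝟙 _ := by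
    rintro q rfl
    rw [hconj_one]
    rfl
  have key₂ : ∀ q q' : QuaternionGroup 2, q = q' → (conj q).left = (conj q').left := by
    rintro q q' rfl
    rfl
  let τ : 𝒳 ⟶ 𝒳 := endo (conj (QuaternionGroup.a 1)) (hconj_snd _)
  let j : 𝒳 ⟶ 𝒳 := endo (conj (QuaternionGroup.xa 0)) (hconj_snd _)
  -- the chart `ι : 𝒰 ⊗ Wo → 𝒳`
  let Θo : U ⊗ specOver (ParamRing e) T ⟶ Pf ⊗ specOver (ParamRing e) T :=
    Over.homMk Θ₁ (by
      rw [← Over.w (snd Pf (specOver (ParamRing e) T)), ← Over.w (snd U (specOver (ParamRing e) T)),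
        reassoc_of% hΘ₁snd])
  have hΘo_left : Θo.left = Θ₁ := rfl
  let ιo : U ⊗ Wo ⟶ Pf ⊗ Wo := nI.hom ≫ Θo ≫ mI.inv
  have hιo_snd : ιo ≫ snd Pf Wo = snd U Wo := by
    change (nI.hom ≫ Θo ≫ mI.inv) ≫ snd Pf Wo = snd U Wo
    rw [Category.assoc, Category.assoc, hmIinv_snd]
    have h1 : Θo ≫ snd Pf (specOver (ParamRing e) T) = snd U (specOver (ParamRing e) T) := Over.OverMorphism.ext hΘ₁snd
    rw [reassoc_of% h1, reassoc_of% hnI_snd, Iso.hom_inv_id, Category.comp_id]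
  have hιo_eq : ∀ g, ((ρU.overAut g).hom ▷ Wo) ≫ ιo = ιo ≫ conj g := by
    intro g
    change ((ρU.overAut g).hom ▷ Wo) ≫ nI.hom ≫ Θo ≫ mI.inv = (nI.hom ≫ Θo ≫ mI.inv) ≫ mI.hom ≫ (σo g).hom ≫ mI.inv
    have h1 : ((ρU.overAut g).hom ▷ specOver (ParamRing e) T) ≫ Θo = Θo ≫ (σo g).hom :=
      Over.OverMorphism.ext (by
        rw [Over.comp_left, Over.comp_left, hΘo_left, hσo_left, ← ActionOver.tensorRight_aut_hom]
        exact hΘ₁eq g)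
    change ((ρU.overAut g).hom ▷ Wo) ≫ (U ◁ ℓo.hom) ≫ Θo ≫ mI.inv = _
    rw [← whisker_exchange_assoc, reassoc_of% h1]
    simp only [Category.assoc, Iso.inv_hom_id_assoc]
    rfl
  -- ### (4) smoothness, properness, geometric irreducibility of `π` (transported from `Pm_T → Spec T`)
  obtain ⟨hTpr, hTsm, hTgi⟩ := Hloc (t * G) (dvd_mul_right t G) htG T
  haveI : SmoothOfRelativeDimension 2 (pullback.snd f W.ι) := by
    haveI := smoothOfRelativeDimension_isStableUnderBaseChange (n := 2)
    exact MorphismProperty.of_isPullback (P := @SmoothOfRelativeDimension 2) sqT hTsm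
  haveI : GeometricallyIrreducible (pullback.snd f W.ι) :=
    MorphismProperty.of_isPullback (P := @GeometricallyIrreducible) sqT hTgi
  haveI : IsProper (pullback.snd f W.ι) := inferInstance
  -- complex points of `W` are coefficient vectors `a` with `t(a) ≠ 0`
  have hpt : ∀ s : AlgPoints (base W) ℂ,
      s.left ≫ W.ι = Spec.map (CommRingCat.ofHom (MvPolynomial.eval (coeffs W s))) ∧
        MvPolynomial.eval (coeffs W s) (t * G) ≠ 0 := by
    intro s
    have hSpec : Spec.map (Spec.preimage (s.left ≫ W.ι)) = s.left ≫ W.ι := Spec.map_preimage _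
    have hcomp : (Spec.preimage (s.left ≫ W.ι)).hom.comp (algebraMap ℂ (MvPolynomial (CIdx e) ℂ)) =
        algebraMap ℂ ℂ := by
      have hw : Spec.map (Spec.preimage (s.left ≫ W.ι)) ≫
          Spec.map (CommRingCat.ofHom (algebraMap ℂ (MvPolynomial (CIdx e) ℂ))) =
            Spec.map (CommRingCat.ofHom (algebraMap ℂ ℂ)) := by
        rw [hSpec]
        exact (Category.assoc _ _ _).trans (Over.w s)
      rw [← Spec.map_comp] at hw
      have := congrArg CommRingCat.Hom.hom (Spec.map_injective hw)
      simpa using this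
    have hφ : (Spec.preimage (s.left ≫ W.ι)).hom = MvPolynomial.eval (coeffs W s) := by
      refine MvPolynomial.ringHom_ext (fun r => ?_) (fun i => ?_)
      · rw [MvPolynomial.eval_C, ← MvPolynomial.algebraMap_eq]
        simpa using RingHom.congr_fun hcomp r
      · rw [MvPolynomial.eval_X]
        rfl
    have h1 : s.left ≫ W.ι = Spec.map (CommRingCat.ofHom (MvPolynomial.eval (coeffs W s))) := by
      rw [← hφ, CommRingCat.ofHom_hom, hSpec]
    let x₀ : Spec (.of ℂ) := ⟨⊥, Ideal.isPrime_bot⟩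
    have hx₀ : (s.left ≫ W.ι) x₀ ∈ W := by
      rw [Scheme.Hom.comp_apply]
      exact (s.left x₀ : W).2
    rw [h1] at hx₀
    exact ⟨h1, (hmemW _ x₀).mp hx₀⟩
  have Hfib : ∀ s : AlgPoints (base W) ℂ,
      IsPullback (pullback.fst π.left s.left ≫ pullback.fst f W.ι) (pullback.snd π.left s.left) f
        (Spec.map (CommRingCat.ofHom (MvPolynomial.eval (coeffs W s)))) := fun s => by
    rw [← (hpt s).1]
    exact (IsPullback.of_hasPullback π.left s.left).paste_horiz (IsPullback.of_hasPullback f W.ι)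
  have h3 : (specOver ℂ ℂ).hom = 𝟙 _ := by
    change Spec.map (CommRingCat.ofHom (RingHom.id ℂ)) = _
    exact Spec.map_id _
  have h4 : ∀ s : AlgPoints (base W) ℂ, (fiberOver π s).hom = pullback.snd π.left s.left := fun s => by
    rw [fiberOver_hom, h3]
    exact Category.comp_id _
  haveI : SmoothOfRelativeDimension 2 π.left := ‹SmoothOfRelativeDimension 2 (pullback.snd f W.ι)›
  haveI : GeometricallyIrreducible π.left := ‹GeometricallyIrreducible (pullback.snd f W.ι)›
  haveI : IsProper π.left := ‹IsProper (pullback.snd f W.ι)›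
  -- ### (5) `Q8FamilyDeck e`
  refine ⟨W, 𝒳, π, τ, j, ιo.left, PrimeSpectrum.basicOpen_mul_le_right t G, ?_,
    ⟨inferInstance, inferInstance, fun s => ?_⟩, ?_, ?_, ?_,
    ⟨hendo_π _ (hconj_snd _), hendo_π _ (hconj_snd _), ?_, ?_, ?_⟩, ?_, congrArg CommaMorphism.left hιo_snd, ?_, ?_, ?_⟩
  · -- (o) a complex point of `W`: a coefficient vector with `t(a) G(a) ≠ 0`
    obtain ⟨a₀, ha₀⟩ : ∃ a : CIdx e → ℂ, MvPolynomial.eval a (t * G) ≠ 0 := by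
      by_contra hc
      push Not at hc
      exact htG (MvPolynomial.funext fun x => by rw [map_zero]; exact hc x)
    let g₀ : Spec (.of ℂ) ⟶ Spec (.of (MvPolynomial (CIdx e) ℂ)) :=
      Spec.map (CommRingCat.ofHom (MvPolynomial.eval a₀))
    have hg₀ : Set.range g₀ ⊆ Set.range W.ι := by
      rintro _ ⟨x, rfl⟩
      rw [Scheme.Opens.range_ι]
      exact (hmemW _ x).mpr ha₀
    obtain ⟨s₀, hs₀⟩ : ∃ s₀ : Spec (.of ℂ) ⟶ (W : Scheme), s₀ ≫ W.ι = g₀ :=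
      ⟨_, IsOpenImmersion.lift_fac W.ι g₀ hg₀⟩
    refine ⟨AlgPoints.mk (X := base W) s₀ ?_⟩
    have hc : (MvPolynomial.eval a₀).comp (algebraMap ℂ (MvPolynomial (CIdx e) ℂ)) = algebraMap ℂ ℂ :=
      RingHom.ext fun r => by simp [MvPolynomial.algebraMap_eq]
    calc s₀ ≫ (base W).hom
        = (s₀ ≫ W.ι) ≫ Spec.map (CommRingCat.ofHom (algebraMap ℂ (MvPolynomial (CIdx e) ℂ))) :=
          (Category.assoc _ _ _).symm
      _ = Spec.map (CommRingCat.ofHom (algebraMap ℂ ℂ)) := by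
          rw [hs₀, ← Spec.map_comp, ← CommRingCat.ofHom_comp, hc]
  · -- (i) the fibre over `s` is a smooth projective geometrically irreducible surface
    refine ⟨?_, ?_, ?_⟩
    · rw [h4]
      haveI := smoothOfRelativeDimension_isStableUnderBaseChange (n := 2)
      exact MorphismProperty.pullback_snd (P := @SmoothOfRelativeDimension 2) _ _ inferInstance
    · letI alg : Algebra (MvPolynomial (CIdx e) ℂ) ℂ := (MvPolynomial.eval (coeffs W s)).toAlgebra
      exact isProjectiveOver_of_isPullback_proj (T := MvPolynomial (CIdx e) ℂ) (L := ℂ) emb hf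
        (fiberOver π s) (pullback.fst π.left s.left ≫ pullback.fst f W.ι) (by rw [h4]; exact Hfib s)
    · rw [h4]
      exact MorphismProperty.pullback_snd (P := @GeometricallyIrreducible) _ _ inferInstance
  · -- (ii) the total space is quasi-projective over `ℂ`
    obtain ⟨P', jj, hP', hjj⟩ :=
      isQuasiProjectiveOver_of_proj_over_specOver (k := ℂ) (MvPolynomial (CIdx e) ℂ) f emb hf
    haveI := hjj
    let i : 𝒳 ⟶ (Over.mk (f ≫ (specOver ℂ (MvPolynomial (CIdx e) ℂ)).hom) : SchemeOver ℂ) :=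
      Over.homMk (pullback.fst f W.ι) (by
        show pullback.fst f W.ι ≫ f ≫ (specOver ℂ (MvPolynomial (CIdx e) ℂ)).hom =
          pullback.snd f W.ι ≫ W.ι ≫
            Spec.map (CommRingCat.ofHom (algebraMap ℂ (MvPolynomial (CIdx e) ℂ)))
        rw [← Category.assoc, pullback.condition, Category.assoc]
        rfl)
    haveI : IsOpenImmersion i.left := inferInstanceAs (IsOpenImmersion (pullback.fst f W.ι))
    refine ⟨P', i ≫ jj, hP', ?_⟩
    rw [Over.comp_left]
    infer_instance
  · -- the base `W` is quasi-projective over `ℂ`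
    obtain ⟨P', jj, hP', hjj⟩ := isQuasiProjectiveOver_specOver (k := ℂ) (MvPolynomial (CIdx e) ℂ)
    haveI := hjj
    let i : base W ⟶ specOver ℂ (MvPolynomial (CIdx e) ℂ) := Over.homMk W.ι rfl
    haveI : IsOpenImmersion i.left := inferInstanceAs (IsOpenImmersion W.ι)
    refine ⟨P', i ≫ jj, hP', ?_⟩
    rw [Over.comp_left]
    infer_instance
  · -- the base is smooth over `ℂ` of relative dimension `#CIdx e`
    haveI := UniversalHypersurface.smoothOfRelativeDimension_specSpzToSpec ℂ (ι := CIdx e)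
    have hsm : SmoothOfRelativeDimension (0 + Nat.card (CIdx e)) (W.ι ≫
        Spec.map (CommRingCat.ofHom (algebraMap ℂ (MvPolynomial (CIdx e) ℂ)))) := inferInstance
    rw [Nat.zero_add, Nat.card_eq_fintype_card] at hsm
    exact hsm
  · -- (iv) `τ⁴ = 1`
    apply Over.OverMorphism.ext
    change (conj (QuaternionGroup.a 1) ≫ conj (QuaternionGroup.a 1) ≫ conj (QuaternionGroup.a 1) ≫
      conj (QuaternionGroup.a 1)).left = 𝟙 _
    rw [hconj_mul, hconj_mul, hconj_mul]
    exact key₁ _ (by decide)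
  · -- `j² = τ²`
    apply Over.OverMorphism.ext
    change (conj (QuaternionGroup.xa 0) ≫ conj (QuaternionGroup.xa 0)).left =
      (conj (QuaternionGroup.a 1) ≫ conj (QuaternionGroup.a 1)).left
    rw [hconj_mul, hconj_mul]
    exact key₂ _ _ (by decide)
  · -- `τ j τ = j`
    apply Over.OverMorphism.ext
    change (conj (QuaternionGroup.a 1) ≫ conj (QuaternionGroup.xa 0) ≫ conj (QuaternionGroup.a 1)).left =
      (conj (QuaternionGroup.xa 0)).left
    rw [hconj_mul, hconj_mul]
    exact key₂ _ _ (by decide)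
  · -- (v) `ι` is an open immersion
    change IsOpenImmersion (nI.hom ≫ Θo ≫ mI.inv).left
    rw [Over.comp_left, Over.comp_left, hΘo_left]
    haveI : IsIso nI.hom.left := inferInstanceAs (IsIso ((Over.forget _).map nI.hom))
    haveI : IsIso mI.inv.left := inferInstanceAs (IsIso ((Over.forget _).map mI.inv))
    infer_instance
  · -- `ι` intertwines `ρ(a 1) ▷ W` with `τ`
    exact congrArg CommaMorphism.left (hιo_eq (QuaternionGroup.a 1))
  · -- `ι` intertwines `ρ(xa 0) ▷ W` with `j`
    exact congrArg CommaMorphism.left (hιo_eq (QuaternionGroup.xa 0))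
  · -- (vi) the chart meets every fibre: `𝒰 ⊗ W → W` is surjective
    haveI : Surjective (snd U (specOver (ParamRing e) T)).left := ⟨hsurj⟩
    haveI : IsIso nI.hom.left := inferInstanceAs (IsIso ((Over.forget _).map nI.hom))
    haveI : IsIso ℓo.inv.left := inferInstanceAs (IsIso ((Over.forget _).map ℓo.inv))
    have h1 : (snd U Wo).left = nI.hom.left ≫ (snd U (specOver (ParamRing e) T)).left ≫ ℓo.inv.left := by
      rw [← Over.comp_left, ← Over.comp_left, reassoc_of% hnI_snd, Iso.hom_inv_id, Category.comp_id]
    have h2 : Surjective (nI.hom.left ≫ (snd U (specOver (ParamRing e) T)).left ≫ ℓo.inv.left) := inferInstance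
    rw [← h1] at h2
    exact h2.surj

/-- **`Q8FamilyDeck e` for every `e ≥ 2`, modulo Kollár's functorial resolution** (`q8FamilyDeck_holds_away` with `G = 1`).
[cite: Kollar2007, Thm. 3.36 and §3.4.1] [cite: EGAIV3, Thm. 8.10.5] -/
theorem q8FamilyDeck_holds (h : Kollar2007_resolutionLiftsAutomorphisms.{0}) (e : ℕ) (he : 2 ≤ e) : Q8FamilyDeck e := by
  obtain ⟨W, 𝒳, π, τ, j, ι, -, hrest⟩ := q8FamilyDeck_holds_away h e he 1 one_ne_zero
  exact ⟨W, 𝒳, π, τ, j, ι, hrest⟩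

end Literature.AlgebraicGeometry.HodgeTheory.Q8Family

end
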